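import Mathlib.Analysis.Complex.PhragmenLindelof
import Literature.Analysis.SpecialFunctions.GammaVerticalBounds
import Literature.NumberTheory.LFunctions.RHLittlewoodZetaBounds
import HarnessLib

/-!
# `ζ(1/2 + it) ≪ (1+|t|)^{δ/2} |ζ(1/2 + δ + it)|` uniformly in `δ`, under RH

Topic: `Literature/NumberTheory/LFunctions`. Two comparison bounds between values of `ζ` at
horizontally displaced points, used in the proof of the deep half of Báez-Duarte's strengthening
of the Nyman–Beurling criterion (L. Báez-Duarte, *A strengthening of the Nyman–Beurling criterion
for the Riemann hypothesis*, Rend. Lincei (9) 14 (2003), 5–11, §2):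

* `Literature.NumberTheory.LFunctions.ZetaRatioRH.norm_riemannZeta_reflect_le` — a uniform, product-form version of
  Báez-Duarte's Lemma 2.2 (unconditional). The PRINTED lemma is the ratio bound "for
  `0 ≤ ε ≤ ε₀ < 1/4` there is `C = C(ε₀)` with `|ζ(1/2 - ε + iτ)/ζ(1/2 + ε + iτ)| ≤ C(1+|τ|)^ε`",
  vendored verbatim as the named fact `Literature.NumberTheory.LFunctions.baezDuarte_zetaRatio_bound` (`NymanBeurling.lean`)
  and discharged in `NymanBeurlingZetaRatio.lean` (`Literature.NumberTheory.LFunctions.baezDuarte_zetaRatio_bound_holds`). Here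
  we prove `‖ζ(1/2 - ε + it)‖ ≤ 8π² (1+|t|)^ε ‖ζ(1/2 + ε + it)‖` for the WIDER range `0 ≤ ε < 1/2`
  with the ABSOLUTE constant `8π²`; the range and the uniform constant are this file's improvement
  over the printed statement (the product form avoids the `0/0` reading of the quotient at common
  zeros and implies the named fact with `C = 8π²`). Printed proof: functional equation and
  Stirling's formula in a vertical strip; here Mathlib's `riemannZeta_one_sub`, `riemannZeta_conj`
  and the elementary Stirling-order bound `Literature.Analysis.SpecialFunctions.GammaVert.norm_fe_factor_le`
  (`GammaVerticalBounds.lean`).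
* `Literature.NumberTheory.LFunctions.ZetaRatioRH.norm_riemannZeta_half_le_of_RH` — under RH there is an absolute `C` with
  `‖ζ(1/2 + it)‖ ≤ C (1+|t|)^{δ/2} ‖ζ(1/2 + δ + it)‖` for all `0 < δ < 1/2` and all real `t`. This is
  the critical-line substitute for the combination "Lemma 2.2 + Lindelöf hypothesis at abscissa
  `1/2 - ε`" of Báez-Duarte's §2.2; it is obtained from Lemma 2.2 by the Phragmén–Lindelöf
  principle (Mathlib `PhragmenLindelof.vertical_strip`) applied on the strip `1/2 ≤ Re u ≤ 5/2` to
  `u ↦ ζ₁(u - δ/2)(u + δ/2 - 1) / (ζ₁(u + δ/2)(u + 1)) · (u + 1)^{-δ/2}` (`ζ₁ = riemannZeta₁`, the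
  entire completion of `(s-1)ζ(s)`; the quotient is holomorphic on `Re u > 1/2 - δ/2` under RH),
  whose modulus on `Re u = 1/2` is `|ζ(1/2-δ/2+it)/ζ(1/2+δ/2+it)| · O(|u+1|^{-δ/2}) ≤ 16π²` by
  Lemma 2.2, is `≤ 2(1-ρ)⁻¹` on `Re u = 5/2` by the Dirichlet series, and grows at most
  polynomially inside by Littlewood's `1/ζ(s) = O(t)` (`RHLittlewoodZetaBounds.lean`) and
  Titchmarsh (2.12.2).

## References

* L. Báez-Duarte, Rend. Lincei (9) Mat. Appl. 14 (2003), 5–11, Lemma 2.2 and §2.2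
  (arXiv:math/0202141).
* E. C. Titchmarsh, *The Theory of the Riemann Zeta-Function*, 2nd ed. (1986), §14.2, §5.1
  (Phragmén–Lindelöf convexity).

The file has no definitions.
-/

noncomputable section

open Complex Filter Topology Metric Set Asymptotics
open scoped Real

namespace Literature.NumberTheory.LFunctions

namespace ZetaRatioRH

open InvZetaRH LittlewoodRH

/-! ### Elementary facts -/

/-- `(1 + x)^3 ≤ 27 e^x` for `x ≥ 0`. [folklore] -/
lemma one_add_pow_three_le_exp {x : ℝ} (hx : 0 ≤ x) : (1 + x) ^ 3 ≤ 27 * Real.exp x := by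
  have h := Real.add_one_le_exp (x / 3)
  have h3 : Real.exp x = Real.exp (x / 3) ^ 3 := by
    rw [← Real.exp_nat_mul]; congr 1; ring
  have h0 : 0 ≤ x / 3 + 1 := by linarith
  have h1 : 1 + x ≤ 3 * (x / 3 + 1) := by linarith
  calc (1 + x) ^ 3 ≤ (3 * (x / 3 + 1)) ^ 3 := by gcongr
    _ = 27 * (x / 3 + 1) ^ 3 := by ring
    _ ≤ 27 * Real.exp (x / 3) ^ 3 := by gcongr
    _ = 27 * Real.exp x := by rw [h3]

/-- `2^{a} ≤ 2` for `a ≤ 1`. [folklore] -/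
lemma two_rpow_le_two {a : ℝ} (ha : a ≤ 1) : (2 : ℝ) ^ a ≤ 2 := by
  calc (2 : ℝ) ^ a ≤ 2 ^ (1 : ℝ) := Real.rpow_le_rpow_of_exponent_le (by norm_num) ha
    _ = 2 := Real.rpow_one 2

/-- Comparison of norms of two points with the same ordinate. [folklore] -/
lemma norm_le_mul_norm_of_sq {x₁ x₂ k t : ℝ} (h : x₁ ^ 2 ≤ k ^ 2 * x₂ ^ 2) (h' : 1 ≤ k) :
    ‖(x₁ : ℂ) + t * I‖ ≤ k * ‖(x₂ : ℂ) + t * I‖ := by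
  have hk : 0 ≤ k := by linarith
  refine (pow_le_pow_iff_left₀ (norm_nonneg _) (by positivity) two_ne_zero).mp ?_
  rw [mul_pow, Complex.sq_norm, Complex.normSq_add_mul_I, Complex.sq_norm, Complex.normSq_add_mul_I]
  have hk2 : 1 ≤ k ^ 2 := one_le_pow₀ h'
  nlinarith [mul_nonneg (sub_nonneg.mpr hk2) (sq_nonneg t)]

/-- `1 + |t| ≤ 2 ‖x + it‖` when `x ≥ 3/2`. [folklore] -/
lemma one_add_abs_le_two_mul_norm {x : ℝ} (hx : 3 / 2 ≤ x) (t : ℝ) :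
    1 + |t| ≤ 2 * ‖(x : ℂ) + t * I‖ := by
  refine (pow_le_pow_iff_left₀ (by positivity) (by positivity) two_ne_zero).mp ?_
  rw [mul_pow, Complex.sq_norm, Complex.normSq_add_mul_I]
  nlinarith [abs_nonneg t, sq_abs t, sq_nonneg (|t| - 1)]

/-- `‖x + it‖ ≤ x + |t|` for `x ≥ 0`. [folklore] -/
lemma norm_ofReal_add_mul_I_le {x : ℝ} (hx : 0 ≤ x) (t : ℝ) : ‖(x : ℂ) + t * I‖ ≤ x + |t| := by
  have := norm_le_abs_re_add_abs_im ((x : ℂ) + t * I)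
  simpa [abs_of_nonneg hx] using this

/-! ### Báez-Duarte's Lemma 2.2 -/

/-- **Báez-Duarte 2003, Lemma 2.2, uniform product form** (unconditional). Printed statement:
"for `0 ≤ ε ≤ ε₀ < 1/4` there is a positive constant `C = C(ε₀)` such that for all `τ`,
`|ζ(1/2 - ε + iτ)/ζ(1/2 + ε + iτ)| ≤ C(1+|τ|)^ε`" — vendored verbatim as the named fact
`Literature.NumberTheory.LFunctions.baezDuarte_zetaRatio_bound` (`NymanBeurling.lean`), discharged by
`Literature.NumberTheory.LFunctions.baezDuarte_zetaRatio_bound_holds` (`NymanBeurlingZetaRatio.lean`). This theorem is the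
strengthening: for `0 ≤ ε < 1/2` (wider range) and all real `t`,
`‖ζ(1/2 - ε + it)‖ ≤ 8π² (1+|t|)^ε ‖ζ(1/2 + ε + it)‖` with the absolute constant `8π²` (uniform in
`ε`; range and constant are this file's improvement, and the product form implies the printed ratio
bound with `C = 8π²`). Proof (as printed: functional equation + Stirling): with `u = 1/2 + ε - it`,
`ζ(1 - u) = 2(2π)^{-u}Γ(u)cos(πu/2)ζ(u)` (`riemannZeta_one_sub`), `ζ(u) = conj ζ(ū)`
(`riemannZeta_conj`) and `‖2(2π)^{-u}Γ(u)cos(πu/2)‖ ≤ 8π²(1+|t|)^{Re u - 1/2}`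
(`GammaVert.norm_fe_factor_le`). [cite: BaezDuarte2003, Lemma 2.2] -/
theorem norm_riemannZeta_reflect_le {ε : ℝ} (hε0 : 0 ≤ ε) (hε : ε < 1 / 2) (t : ℝ) :
    ‖riemannZeta (1 / 2 - ε + t * I)‖ ≤
      8 * π ^ 2 * (1 + |t|) ^ ε * ‖riemannZeta (1 / 2 + ε + t * I)‖ := by
  set w : ℂ := 1 / 2 + ε + t * I with hw
  set u : ℂ := (starRingEnd ℂ) w with hu
  have hure : u.re = 1 / 2 + ε := by simp [hu, hw]
  have huim : u.im = -t := by simp [hu, hw]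
  have h1u : 1 - u = 1 / 2 - ε + t * I := by
    apply Complex.ext
    · simp [hu, hw]; ring
    · simp [hu, hw]
  have hun : ∀ n : ℕ, u ≠ -n := by
    intro n h
    have := congrArg re h
    rw [hure] at this
    simp at this
    linarith [n.cast_nonneg (α := ℝ)]
  have hu1 : u ≠ 1 := by
    intro h
    have := congrArg re h
    rw [hure] at this
    simp at this
    linarith
  have hFE := riemannZeta_one_sub hun hu1
  rw [h1u] at hFE
  have hζu : riemannZeta u = (starRingEnd ℂ) (riemannZeta w) := riemannZeta_conj w
  rw [hFE, hζu, norm_mul, Complex.norm_conj]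
  have hfac := Literature.Analysis.SpecialFunctions.GammaVert.norm_fe_factor_le (s := u) (by rw [hure]; linarith)
    (by rw [hure]; linarith)
  rw [hure, huim, abs_neg, show (1 / 2 + ε - 1 / 2 : ℝ) = ε by ring] at hfac
  gcongr

/-! ### The auxiliary function of the Phragmén–Lindelöf argument -/


/-- The modulus of `g_δ(u)` off the two exceptional points: for `u - δ/2 ≠ 1 ≠ u + δ/2`,
`‖g_δ(u)‖ = ‖u-δ/2-1‖ ‖ζ(u-δ/2)‖ ‖ζ(u+δ/2)‖⁻¹ ‖u+1‖⁻¹ ‖u+1‖^{-δ/2}`. [folklore] -/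
lemma norm_gPL_eq (δ : ℝ) {u : ℂ} (h1 : u - δ / 2 ≠ 1) (h2 : u + δ / 2 ≠ 1) :
    ‖(riemannZeta₁ (u - δ / 2) * ((u + δ / 2 - 1) / riemannZeta₁ (u + δ / 2)) * ((u + 1)⁻¹ * (u + 1) ^ (((-(δ / 2) : ℝ)) : ℂ)))‖ = ‖u - δ / 2 - 1‖ * ‖riemannZeta (u - δ / 2)‖ * ‖riemannZeta (u + δ / 2)‖⁻¹ *
      (‖u + 1‖⁻¹ * ‖u + 1‖ ^ (-(δ / 2))) := by
  -- `ζ₁(s) = (s-1)ζ(s)` off `s = 1` (public copy: `Literature.NumberTheory.LFunctions.riemannZeta₁_eq_mul`, `ZetaLogDerivDisc.lean`)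
  have e1 : riemannZeta₁ (u - δ / 2) = (u - δ / 2 - 1) * riemannZeta (u - δ / 2) := by
    rw [riemannZeta_eq_inv_sub_mul h1, ← mul_assoc, mul_inv_cancel₀ (sub_ne_zero.mpr h1), one_mul]
  rw [e1, ← inv_riemannZeta_eq _ h2, norm_mul, norm_mul, norm_mul, norm_mul,
    norm_inv, norm_inv, norm_cpow_real]

/-- Under RH, `g_δ` (`0 < δ`) is holomorphic on the half-plane `Re u > 1/2 - δ/2`. [folklore] -/
lemma differentiableOn_gPL (hRH : RiemannHypothesis) {δ : ℝ} (hδ : 0 < δ) (hδ1 : δ < 1) :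
    DifferentiableOn ℂ ((fun u : ℂ ↦ riemannZeta₁ (u - δ / 2) * ((u + δ / 2 - 1) / riemannZeta₁ (u + δ / 2)) * ((u + 1)⁻¹ * (u + 1) ^ (((-(δ / 2) : ℝ)) : ℂ)))) {u : ℂ | 1 / 2 - δ / 2 < u.re} := by
  intro u hu
  have hu' : 1 / 2 - δ / 2 < u.re := hu
  have hden : riemannZeta₁ (u + δ / 2) ≠ 0 := by
    refine riemannZeta₁_ne_zero_of_RH hRH ?_
    simp; linarith
  have hslit : u + 1 ∈ slitPlane := by left; simp; linarith
  refine DifferentiableAt.differentiableWithinAt ?_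
  refine DifferentiableAt.mul (DifferentiableAt.mul ?_ ?_) ?_
  · exact (differentiable_riemannZeta₁.comp (differentiable_id.sub_const _)).differentiableAt
  · refine DifferentiableAt.div (by fun_prop) ?_ hden
    exact (differentiable_riemannZeta₁.comp (differentiable_id.add_const _)).differentiableAt
  · refine DifferentiableAt.mul ?_ ?_
    · exact (differentiableAt_id.add_const 1).inv (slitPlane_ne_zero hslit)
    · exact (differentiableAt_id.add_const 1).cpow_const hslit

/-- The last factor: `‖(u+1)⁻¹ (u+1)^{-δ/2}‖ ≤ ‖u+1‖⁻¹ ≤ 1` for `Re u ≥ 1/2`, `δ ≥ 0`. [folklore] -/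
lemma norm_last_factor_le {δ : ℝ} (hδ : 0 ≤ δ) {u : ℂ} (hu : 1 / 2 ≤ u.re) :
    ‖(u + 1)⁻¹ * (u + 1) ^ (((-(δ / 2) : ℝ)) : ℂ)‖ ≤ ‖u + 1‖⁻¹ ∧ ‖u + 1‖⁻¹ ≤ 1 := by
  have h1 : 1 ≤ ‖u + 1‖ := by
    have := abs_re_le_norm (u + 1)
    rw [add_re, one_re, abs_of_pos (by linarith)] at this
    linarith
  rw [norm_mul, norm_inv, norm_cpow_real]
  refine ⟨?_, inv_le_one_of_one_le₀ h1⟩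
  have h3 : ‖u + 1‖ ^ (-(δ / 2)) ≤ 1 := Real.rpow_le_one_of_one_le_of_nonpos h1 (by linarith)
  have h4 : 0 ≤ ‖u + 1‖⁻¹ := inv_nonneg.mpr (norm_nonneg _)
  calc ‖u + 1‖⁻¹ * ‖u + 1‖ ^ (-(δ / 2)) ≤ ‖u + 1‖⁻¹ * 1 := by gcongr
    _ = ‖u + 1‖⁻¹ := mul_one _

/-- **Left edge.** Under RH, for `0 < δ < 1` and `Re u = 1/2`: `‖g_δ(u)‖ ≤ 16π²`
(Báez-Duarte's Lemma 2.2 at `ε = δ/2`). [cite: BaezDuarte2003, Lemma 2.2] -/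
lemma norm_gPL_le_left (hRH : RiemannHypothesis) {δ : ℝ} (hδ : 0 < δ) (hδ1 : δ < 1) {z : ℂ}
    (hz : z.re = 1 / 2) : ‖(riemannZeta₁ (z - δ / 2) * ((z + δ / 2 - 1) / riemannZeta₁ (z + δ / 2)) * ((z + 1)⁻¹ * (z + 1) ^ (((-(δ / 2) : ℝ)) : ℂ)))‖ ≤ 16 * π ^ 2 := by
  set t : ℝ := z.im with ht
  have hz_eq : z = (((1 / 2 : ℝ)) : ℂ) + t * I := by
    apply Complex.ext <;> simp [hz, ht]
  have hs'_eq : z - δ / 2 = 1 / 2 - ↑(δ / 2) + t * I := by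
    rw [hz_eq]; push_cast; ring
  have hw_eq : z + δ / 2 = 1 / 2 + ↑(δ / 2) + t * I := by
    rw [hz_eq]; push_cast; ring
  have hs'1 : z - δ / 2 ≠ 1 := by
    intro h; have := congrArg re h; simp [hz] at this; linarith
  have hw1 : z + δ / 2 ≠ 1 := by
    intro h; have := congrArg re h; simp [hz] at this; linarith
  have hwre : 1 / 2 < (z + δ / 2).re := by simp [hz]; linarith
  have hζw : riemannZeta (z + δ / 2) ≠ 0 := riemannZeta_ne_zero_of_RH hRH hwre
  have hζwpos : 0 < ‖riemannZeta (z + δ / 2)‖ := norm_pos_iff.mpr hζw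
  -- Lemma 2.2
  have hL22 : ‖riemannZeta (z - δ / 2)‖ ≤
      8 * π ^ 2 * (1 + |t|) ^ (δ / 2) * ‖riemannZeta (z + δ / 2)‖ := by
    rw [hs'_eq, hw_eq]
    exact norm_riemannZeta_reflect_le (by linarith) (by linarith) t
  -- geometry
  have hz1 : z + 1 = (((3 / 2 : ℝ)) : ℂ) + t * I := by rw [hz_eq]; push_cast; ring
  have hs1 : z - δ / 2 - 1 = (((-(1 / 2 + δ / 2) : ℝ)) : ℂ) + t * I := by
    rw [hz_eq]; push_cast; ring
  have hz1pos : 0 < ‖z + 1‖ := by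
    rw [hz1]; refine norm_pos_iff.mpr ?_
    intro h; have := congrArg re h; norm_num at this
  have hcmp : ‖z - δ / 2 - 1‖ ≤ ‖z + 1‖ := by
    rw [hz1, hs1]
    have := norm_le_mul_norm_of_sq (x₁ := -(1 / 2 + δ / 2)) (x₂ := 3 / 2) (k := 1) (t := t)
      (by nlinarith) le_rfl
    simpa using this
  have hcmp2 : 1 + |t| ≤ 2 * ‖z + 1‖ := by
    rw [hz1]; exact one_add_abs_le_two_mul_norm le_rfl t
  have hpow2 : (1 + |t|) ^ (δ / 2) * ‖z + 1‖ ^ (-(δ / 2)) ≤ 2 := by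
    have h1 : (1 + |t|) ^ (δ / 2) ≤ (2 * ‖z + 1‖) ^ (δ / 2) :=
      Real.rpow_le_rpow (by positivity) hcmp2 (by linarith)
    have h2 : (2 * ‖z + 1‖) ^ (δ / 2) = 2 ^ (δ / 2) * ‖z + 1‖ ^ (δ / 2) :=
      Real.mul_rpow (by norm_num) (norm_nonneg _)
    have h3 : (2 : ℝ) ^ (δ / 2) ≤ 2 := two_rpow_le_two (by linarith)
    have h4 : ‖z + 1‖ ^ (δ / 2) * ‖z + 1‖ ^ (-(δ / 2)) = 1 := by
      rw [Real.rpow_neg (norm_nonneg _), mul_inv_cancel₀]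
      exact (Real.rpow_pos_of_pos hz1pos _).ne'
    have h5 : 0 ≤ ‖z + 1‖ ^ (-(δ / 2)) := Real.rpow_nonneg (norm_nonneg _) _
    have h6 : 0 ≤ ‖z + 1‖ ^ (δ / 2) := Real.rpow_nonneg (norm_nonneg _) _
    calc (1 + |t|) ^ (δ / 2) * ‖z + 1‖ ^ (-(δ / 2))
        ≤ (2 ^ (δ / 2) * ‖z + 1‖ ^ (δ / 2)) * ‖z + 1‖ ^ (-(δ / 2)) := by
          rw [← h2]; gcongr
      _ ≤ (2 * ‖z + 1‖ ^ (δ / 2)) * ‖z + 1‖ ^ (-(δ / 2)) := by gcongr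
      _ = 2 * (‖z + 1‖ ^ (δ / 2) * ‖z + 1‖ ^ (-(δ / 2))) := by ring
      _ = 2 := by rw [h4, mul_one]
  rw [norm_gPL_eq δ hs'1 hw1]
  have hπ := Real.pi_pos
  calc ‖z - δ / 2 - 1‖ * ‖riemannZeta (z - δ / 2)‖ * ‖riemannZeta (z + δ / 2)‖⁻¹ *
        (‖z + 1‖⁻¹ * ‖z + 1‖ ^ (-(δ / 2)))
      ≤ ‖z + 1‖ * (8 * π ^ 2 * (1 + |t|) ^ (δ / 2) * ‖riemannZeta (z + δ / 2)‖) *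
          ‖riemannZeta (z + δ / 2)‖⁻¹ * (‖z + 1‖⁻¹ * ‖z + 1‖ ^ (-(δ / 2))) := by
        gcongr
    _ = 8 * π ^ 2 * ((1 + |t|) ^ (δ / 2) * ‖z + 1‖ ^ (-(δ / 2))) *
          (‖riemannZeta (z + δ / 2)‖ * ‖riemannZeta (z + δ / 2)‖⁻¹) * (‖z + 1‖ * ‖z + 1‖⁻¹) := by
        ring
    _ = 8 * π ^ 2 * ((1 + |t|) ^ (δ / 2) * ‖z + 1‖ ^ (-(δ / 2))) := by
        rw [mul_inv_cancel₀ hζwpos.ne', mul_inv_cancel₀ hz1pos.ne', mul_one, mul_one]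
    _ ≤ 8 * π ^ 2 * 2 := by gcongr
    _ = 16 * π ^ 2 := by ring

/-- **Right edge.** For `0 < δ < 1` and `Re u = 5/2`: `‖g_δ(u)‖ ≤ 2(1-ρ)⁻¹` (Dirichlet series
bounds `‖ζ‖ ≤ 1 + ρ`, `‖ζ⁻¹‖ ≤ (1-ρ)⁻¹` on `Re s ≥ 2`). [folklore] -/
lemma norm_gPL_le_right {δ : ℝ} (hδ : 0 < δ) (hδ1 : δ < 1) {z : ℂ} (hz : z.re = 5 / 2) :
    ‖(riemannZeta₁ (z - δ / 2) * ((z + δ / 2 - 1) / riemannZeta₁ (z + δ / 2)) * ((z + 1)⁻¹ * (z + 1) ^ (((-(δ / 2) : ℝ)) : ℂ)))‖ ≤ 2 * (1 - rho)⁻¹ := by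
  set t : ℝ := z.im with ht
  have hz_eq : z = (((5 / 2 : ℝ)) : ℂ) + t * I := by
    apply Complex.ext <;> simp [hz, ht]
  have hs're : (z - δ / 2).re = 5 / 2 - δ / 2 := by simp [hz]
  have hwre : (z + δ / 2).re = 5 / 2 + δ / 2 := by simp [hz]
  have hs'1 : z - δ / 2 ≠ 1 := by
    intro h; have := congrArg re h; rw [hs're] at this; simp at this; linarith
  have hw1 : z + δ / 2 ≠ 1 := by
    intro h; have := congrArg re h; rw [hwre] at this; simp at this; linarith
  -- `‖ζ(s)‖ ≤ 2` for `Re s ≥ 2` (from `‖ζ(s) - 1‖ ≤ ρ < 1`; cf. `InvZetaRH.norm_riemannZeta_le_of_two_le`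
  -- in `RHZetaGrowthProofs.lean`, not imported here)
  have hζs' : ‖riemannZeta (z - δ / 2)‖ ≤ 2 := by
    have h := norm_riemannZeta_sub_one_le (s := z - δ / 2) (by rw [hs're]; linarith)
    have h1 := norm_le_norm_add_norm_sub' (riemannZeta (z - δ / 2)) 1
    have hρ := rho_lt_one
    simp only [norm_one] at *
    linarith
  have hζw : ‖riemannZeta (z + δ / 2)‖⁻¹ ≤ (1 - rho)⁻¹ := by
    rw [← norm_inv]
    exact norm_inv_riemannZeta_le_of_two_le (by rw [hwre]; linarith)
  have hz1 : z + 1 = (((7 / 2 : ℝ)) : ℂ) + t * I := by rw [hz_eq]; push_cast; ring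
  have hs1 : z - δ / 2 - 1 = (((3 / 2 - δ / 2) : ℝ) : ℂ) + t * I := by
    rw [hz_eq]; push_cast; ring
  have hz1pos : 0 < ‖z + 1‖ := by
    rw [hz1]; refine norm_pos_iff.mpr ?_
    intro h; have := congrArg re h; norm_num at this
  have hcmp : ‖z - δ / 2 - 1‖ ≤ ‖z + 1‖ := by
    rw [hz1, hs1]
    have := norm_le_mul_norm_of_sq (x₁ := 3 / 2 - δ / 2) (x₂ := 7 / 2) (k := 1) (t := t)
      (by nlinarith) le_rfl
    simpa using this
  have hlast := (norm_last_factor_le hδ.le (u := z) (by rw [hz]; norm_num)).1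
  have hρ := rho_lt_one
  have hiρ : 0 < (1 - rho)⁻¹ := inv_pos.mpr (by linarith)
  calc ‖(riemannZeta₁ (z - δ / 2) * ((z + δ / 2 - 1) / riemannZeta₁ (z + δ / 2)) * ((z + 1)⁻¹ * (z + 1) ^ (((-(δ / 2) : ℝ)) : ℂ)))‖ = ‖riemannZeta₁ (z - δ / 2)‖ * ‖(z + δ / 2 - 1) / riemannZeta₁ (z + δ / 2)‖ *
        ‖(z + 1)⁻¹ * (z + 1) ^ (((-(δ / 2) : ℝ)) : ℂ)‖ := by
        simp only [norm_mul]
    _ = ‖z - δ / 2 - 1‖ * ‖riemannZeta (z - δ / 2)‖ * ‖riemannZeta (z + δ / 2)‖⁻¹ *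
        ‖(z + 1)⁻¹ * (z + 1) ^ (((-(δ / 2) : ℝ)) : ℂ)‖ := by
        have e1 : riemannZeta₁ (z - δ / 2) = (z - δ / 2 - 1) * riemannZeta (z - δ / 2) := by
          rw [riemannZeta_eq_inv_sub_mul hs'1, ← mul_assoc, mul_inv_cancel₀ (sub_ne_zero.mpr hs'1),
            one_mul]
        rw [e1, ← inv_riemannZeta_eq _ hw1, norm_mul, norm_inv]
    _ ≤ ‖z + 1‖ * 2 * (1 - rho)⁻¹ * ‖z + 1‖⁻¹ := by gcongr
    _ = 2 * (1 - rho)⁻¹ * (‖z + 1‖ * ‖z + 1‖⁻¹) := by ring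
    _ = 2 * (1 - rho)⁻¹ := by rw [mul_inv_cancel₀ hz1pos.ne', mul_one]

/-- **A priori growth.** Under RH, for `0 < δ < 1`, `‖g_δ(u)‖ ≤ K (1 + |Im u|)^3` on the closed
strip `1/2 ≤ Re u ≤ 5/2` (Titchmarsh (2.12.2) for `ζ₁(u-δ/2)`, Littlewood's (14.2.6) for
`(u+δ/2-1)/ζ₁(u+δ/2)`). [folklore] -/
lemma norm_gPL_le_growth (hRH : RiemannHypothesis) {δ : ℝ} (hδ : 0 < δ) (hδ1 : δ < 1) :
    ∃ K : ℝ, 0 < K ∧ ∀ u : ℂ, 1 / 2 ≤ u.re → u.re ≤ 5 / 2 →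
      ‖(riemannZeta₁ (u - δ / 2) * ((u + δ / 2 - 1) / riemannZeta₁ (u + δ / 2)) * ((u + 1)⁻¹ * (u + 1) ^ (((-(δ / 2) : ℝ)) : ℂ)))‖ ≤ K * (1 + |u.im|) ^ 3 := by
  obtain ⟨C₁, hC₁, hL⟩ := norm_sub_one_div_riemannZeta₁_le_of_RH hRH
    (show (1 : ℝ) / 2 < 1 / 2 + δ / 2 by linarith) one_pos
  have h18 : 0 < 18 / (1 - δ) := by
    have : 0 < 1 - δ := by linarith
    positivity
  refine ⟨(3 + 18 / (1 - δ)) * C₁, by positivity, fun u hu1 hu2 ↦ ?_⟩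
  set s' : ℂ := u - δ / 2 with hs'
  set w : ℂ := u + δ / 2 with hw
  have hs're : s'.re = u.re - δ / 2 := by simp [hs']
  have hs'im : s'.im = u.im := by simp [hs']
  have hwre : w.re = u.re + δ / 2 := by simp [hw]
  have hwim : w.im = u.im := by simp [hw]
  have hs'pos : 0 < s'.re := by rw [hs're]; linarith
  have hA := Literature.NumberTheory.LFunctions.norm_riemannZeta₁_le_of_re_pos hs'pos
  have hX : 0 ≤ |u.im| := abs_nonneg _
  have hns' : ‖s'‖ ≤ 3 + |u.im| := by
    have := norm_le_abs_re_add_abs_im s'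
    rw [hs're, hs'im, abs_of_pos (by linarith)] at this
    linarith
  have hns'1 : ‖s' - 1‖ ≤ 3 + |u.im| := by
    have := norm_le_abs_re_add_abs_im (s' - 1)
    rw [sub_re, one_re, hs're, sub_im, one_im, sub_zero, hs'im] at this
    have : |u.re - δ / 2 - 1| ≤ 3 := by rw [abs_le]; constructor <;> linarith
    linarith
  have hre_inv : 1 / s'.re ≤ 2 / (1 - δ) := by
    rw [hs're, div_le_div_iff₀ (by linarith) (by linarith)]
    nlinarith
  have hζ₁ : ‖riemannZeta₁ s'‖ ≤ (3 + |u.im|) + (3 + |u.im|) ^ 2 * (2 / (1 - δ)) := by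
    calc ‖riemannZeta₁ s'‖ ≤ ‖s'‖ + ‖s'‖ * ‖s' - 1‖ / s'.re := hA
      _ = ‖s'‖ + ‖s'‖ * ‖s' - 1‖ * (1 / s'.re) := by ring
      _ ≤ (3 + |u.im|) + (3 + |u.im|) * (3 + |u.im|) * (2 / (1 - δ)) := by gcongr
      _ = (3 + |u.im|) + (3 + |u.im|) ^ 2 * (2 / (1 - δ)) := by ring
  have hLw : ‖(w - 1) / riemannZeta₁ w‖ ≤ C₁ * (1 + |u.im|) := by
    have := hL w (by rw [hwre]; linarith)
    rwa [hwim, Real.rpow_one] at this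
  obtain ⟨hl1, hl2⟩ := norm_last_factor_le hδ.le hu1
  have hlast : ‖(u + 1)⁻¹ * (u + 1) ^ (((-(δ / 2) : ℝ)) : ℂ)‖ ≤ 1 := hl1.trans hl2
  have h3 : (3 + |u.im|) + (3 + |u.im|) ^ 2 * (2 / (1 - δ)) ≤
      (3 + 18 / (1 - δ)) * (1 + |u.im|) ^ 2 := by
    have e0 : 0 ≤ 2 / (1 - δ) := by positivity
    have e1 : (3 + |u.im|) ≤ 3 * (1 + |u.im|) ^ 2 := by nlinarith
    have e2 : (3 + |u.im|) ^ 2 * (2 / (1 - δ)) ≤ 9 * (1 + |u.im|) ^ 2 * (2 / (1 - δ)) := by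
      gcongr; nlinarith
    have e3 : 9 * (1 + |u.im|) ^ 2 * (2 / (1 - δ)) = 18 / (1 - δ) * (1 + |u.im|) ^ 2 := by ring
    nlinarith
  calc ‖(riemannZeta₁ (u - δ / 2) * ((u + δ / 2 - 1) / riemannZeta₁ (u + δ / 2)) * ((u + 1)⁻¹ * (u + 1) ^ (((-(δ / 2) : ℝ)) : ℂ)))‖ = ‖riemannZeta₁ s'‖ * ‖(w - 1) / riemannZeta₁ w‖ *
        ‖(u + 1)⁻¹ * (u + 1) ^ (((-(δ / 2) : ℝ)) : ℂ)‖ := by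
        simp only [norm_mul, hs', hw]
    _ ≤ ((3 + |u.im|) + (3 + |u.im|) ^ 2 * (2 / (1 - δ))) * (C₁ * (1 + |u.im|)) * 1 := by
        gcongr
    _ ≤ (3 + 18 / (1 - δ)) * (1 + |u.im|) ^ 2 * (C₁ * (1 + |u.im|)) * 1 := by gcongr
    _ = (3 + 18 / (1 - δ)) * C₁ * (1 + |u.im|) ^ 3 := by ring

/-! ### The Phragmén–Lindelöf comparison under RH -/

/-- **Ratio bound on the critical line under RH.** Assume RH. There is an absolute constant `C`
(namely `12(16π² + 2(1-ρ)⁻¹)`, `ρ = π²/6 - 1`) such that for all `0 < δ < 1/2` and all real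
`t`, `‖ζ(1/2 + it)‖ ≤ C (1+|t|)^{δ/2} ‖ζ(1/2 + δ + it)‖` (for `δ < 1/2` the point `1/2 + δ + it`
is never the pole). Proof: Phragmén–Lindelöf
(`PhragmenLindelof.vertical_strip`) on the strip `1/2 ≤ Re u ≤ 5/2` for
`g_δ(u) = ζ₁(u-δ/2) · (u+δ/2-1)/ζ₁(u+δ/2) · (u+1)⁻¹(u+1)^{-δ/2}`, bounded by `16π²` on `Re u = 1/2`
(Lemma 2.2), by `2(1-ρ)⁻¹` on `Re u = 5/2`, and of polynomial growth inside; evaluate at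
`u = 1/2 + δ/2 + it`. This is the critical-line form of "Lemma 2.2 + the Lindelöf hypothesis at
abscissa `1/2 - ε`, which follows from RH" in Báez-Duarte's §2.2.
[cite: BaezDuarte2003, §2.2 and Lemma 2.2] -/
theorem norm_riemannZeta_half_le_of_RH (hRH : RiemannHypothesis) :
    ∃ C : ℝ, 0 < C ∧ ∀ δ : ℝ, 0 < δ → δ < 1 / 2 → ∀ t : ℝ,
      ‖riemannZeta (1 / 2 + t * I)‖ ≤
        C * (1 + |t|) ^ (δ / 2) * ‖riemannZeta (1 / 2 + δ + t * I)‖ := by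
  set C₀ : ℝ := 16 * π ^ 2 + 2 * (1 - rho)⁻¹ with hC₀
  have hρ := rho_lt_one
  have hiρ : 0 < (1 - rho)⁻¹ := inv_pos.mpr (by linarith)
  have hπ := Real.pi_pos
  have hC₀pos : 0 < C₀ := by positivity
  refine ⟨12 * C₀, by positivity, fun δ hδ hδ12 t₀ ↦ ?_⟩
  have hδ1 : δ < 1 := by linarith
  -- Phragmén–Lindelöf hypotheses
  have hdc : DiffContOnCl ℂ ((fun u : ℂ ↦ riemannZeta₁ (u - δ / 2) * ((u + δ / 2 - 1) / riemannZeta₁ (u + δ / 2)) * ((u + 1)⁻¹ * (u + 1) ^ (((-(δ / 2) : ℝ)) : ℂ)))) (re ⁻¹' Ioo (1 / 2) (5 / 2)) := by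
    refine ((differentiableOn_gPL hRH hδ hδ1).mono ?_).diffContOnCl
    refine (continuous_re.closure_preimage_subset _).trans ?_
    intro u hu
    rw [closure_Ioo (by norm_num)] at hu
    show 1 / 2 - δ / 2 < u.re
    have : 1 / 2 ≤ u.re := hu.1
    linarith
  obtain ⟨K, hK, hgrowth⟩ := norm_gPL_le_growth hRH hδ hδ1
  have hB : ∃ c < π / (5 / 2 - 1 / 2 : ℝ), ∃ B,
      ((fun u : ℂ ↦ riemannZeta₁ (u - δ / 2) * ((u + δ / 2 - 1) / riemannZeta₁ (u + δ / 2)) * ((u + 1)⁻¹ * (u + 1) ^ (((-(δ / 2) : ℝ)) : ℂ)))) =O[comap (_root_.abs ∘ im) atTop ⊓ 𝓟 (re ⁻¹' Ioo (1 / 2) (5 / 2))]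
        fun z ↦ Real.exp (B * Real.exp (c * |z.im|)) := by
    refine ⟨1 / 2, ?_, 2, ?_⟩
    · have := Real.pi_gt_three
      rw [lt_div_iff₀ (by norm_num)]
      linarith
    refine IsBigO.of_bound (27 * K) ?_
    rw [eventually_inf_principal]
    refine Eventually.of_forall fun z hz ↦ ?_
    have hz' : 1 / 2 < z.re ∧ z.re < 5 / 2 := hz
    have h1 := hgrowth z hz'.1.le hz'.2.le
    have hX : 0 ≤ |z.im| := abs_nonneg _
    have h2 := one_add_pow_three_le_exp hX
    have h3 : Real.exp |z.im| ≤ Real.exp (2 * Real.exp (1 / 2 * |z.im|)) := by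
      refine Real.exp_le_exp.mpr ?_
      have := Real.add_one_le_exp (1 / 2 * |z.im|)
      linarith
    rw [Real.norm_eq_abs, abs_of_pos (Real.exp_pos _)]
    calc ‖(riemannZeta₁ (z - δ / 2) * ((z + δ / 2 - 1) / riemannZeta₁ (z + δ / 2)) * ((z + 1)⁻¹ * (z + 1) ^ (((-(δ / 2) : ℝ)) : ℂ)))‖ ≤ K * (1 + |z.im|) ^ 3 := h1
      _ ≤ K * (27 * Real.exp |z.im|) := by gcongr
      _ ≤ K * (27 * Real.exp (2 * Real.exp (1 / 2 * |z.im|))) := by gcongr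
      _ = 27 * K * Real.exp (2 * Real.exp (1 / 2 * |z.im|)) := by ring
  have hleft : ∀ z : ℂ, z.re = 1 / 2 → ‖(riemannZeta₁ (z - δ / 2) * ((z + δ / 2 - 1) / riemannZeta₁ (z + δ / 2)) * ((z + 1)⁻¹ * (z + 1) ^ (((-(δ / 2) : ℝ)) : ℂ)))‖ ≤ C₀ := fun z hz ↦
    (norm_gPL_le_left hRH hδ hδ1 hz).trans (by rw [hC₀]; linarith)
  have hright : ∀ z : ℂ, z.re = 5 / 2 → ‖(riemannZeta₁ (z - δ / 2) * ((z + δ / 2 - 1) / riemannZeta₁ (z + δ / 2)) * ((z + 1)⁻¹ * (z + 1) ^ (((-(δ / 2) : ℝ)) : ℂ)))‖ ≤ C₀ := fun z hz ↦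
    (norm_gPL_le_right hδ hδ1 hz).trans (by rw [hC₀]; nlinarith)
  -- Phragmén–Lindelöf at `u = 1/2 + δ/2 + it₀`
  set z₀ : ℂ := (((1 / 2 + δ / 2 : ℝ)) : ℂ) + t₀ * I with hz₀
  have hz₀re : z₀.re = 1 / 2 + δ / 2 := by simp [hz₀]
  have hPL : ‖(riemannZeta₁ (z₀ - δ / 2) * ((z₀ + δ / 2 - 1) / riemannZeta₁ (z₀ + δ / 2)) * ((z₀ + 1)⁻¹ * (z₀ + 1) ^ (((-(δ / 2) : ℝ)) : ℂ)))‖ ≤ C₀ :=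
    PhragmenLindelof.vertical_strip (f := (fun u : ℂ ↦ riemannZeta₁ (u - δ / 2) * ((u + δ / 2 - 1) / riemannZeta₁ (u + δ / 2)) * ((u + 1)⁻¹ * (u + 1) ^ (((-(δ / 2) : ℝ)) : ℂ)))) (z := z₀) hdc hB hleft hright
      (by rw [hz₀re]; linarith) (by rw [hz₀re]; linarith)
  have hs_eq : z₀ - δ / 2 = 1 / 2 + t₀ * I := by rw [hz₀]; push_cast; ring
  have hw'_eq : z₀ + δ / 2 = 1 / 2 + δ + t₀ * I := by rw [hz₀]; push_cast; ring
  have hs1 : z₀ - δ / 2 ≠ 1 := by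
    intro h; have := congrArg re h; norm_num [hz₀] at this
  have hw'1 : z₀ + δ / 2 ≠ 1 := by
    intro h; have := congrArg re h; norm_num [hz₀] at this; linarith
  have hw're : 1 / 2 < (z₀ + δ / 2).re := by simp [hz₀]; linarith
  have hζw' : riemannZeta (z₀ + δ / 2) ≠ 0 := riemannZeta_ne_zero_of_RH hRH hw're
  rw [norm_gPL_eq δ hs1 hw'1] at hPL
  have hz1 : z₀ + 1 = (((3 / 2 + δ / 2 : ℝ)) : ℂ) + t₀ * I := by rw [hz₀]; push_cast; ring
  have hsm1 : z₀ - δ / 2 - 1 = (((-(1 / 2) : ℝ)) : ℂ) + t₀ * I := by rw [hz₀]; push_cast; ring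
  rw [hsm1, hs_eq, hw'_eq, hz1] at hPL
  -- positivity of the pieces
  have hs1pos : 0 < ‖(((-(1 / 2) : ℝ)) : ℂ) + t₀ * I‖ := by
    refine norm_pos_iff.mpr ?_
    intro h; have := congrArg re h; norm_num at this
  have hz1pos : 0 < ‖(((3 / 2 + δ / 2 : ℝ)) : ℂ) + t₀ * I‖ := by
    refine norm_pos_iff.mpr ?_
    intro h; have := congrArg re h; simp at this; linarith
  have hζw'pos : 0 < ‖riemannZeta (1 / 2 + δ + t₀ * I)‖ := by
    rw [← hw'_eq]; exact norm_pos_iff.mpr hζw'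
  -- geometry of the three points
  have hcmp1 : ‖(((3 / 2 + δ / 2 : ℝ)) : ℂ) + t₀ * I‖ ≤ 6 * ‖(((-(1 / 2) : ℝ)) : ℂ) + t₀ * I‖ :=
    norm_le_mul_norm_of_sq (by nlinarith) (by norm_num)
  have hcmp2 : ‖(((3 / 2 + δ / 2 : ℝ)) : ℂ) + t₀ * I‖ ≤ 2 * (1 + |t₀|) := by
    have := norm_ofReal_add_mul_I_le (x := 3 / 2 + δ / 2) (by linarith) t₀
    linarith [abs_nonneg t₀]
  have hpow : ‖(((3 / 2 + δ / 2 : ℝ)) : ℂ) + t₀ * I‖ ^ (δ / 2) ≤ 2 * (1 + |t₀|) ^ (δ / 2) := by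
    have h1 : ‖(((3 / 2 + δ / 2 : ℝ)) : ℂ) + t₀ * I‖ ^ (δ / 2) ≤ (2 * (1 + |t₀|)) ^ (δ / 2) :=
      Real.rpow_le_rpow (norm_nonneg _) hcmp2 (by linarith)
    have h2 : (2 * (1 + |t₀|)) ^ (δ / 2) = 2 ^ (δ / 2) * (1 + |t₀|) ^ (δ / 2) :=
      Real.mul_rpow (by norm_num) (by positivity)
    have h3 : (2 : ℝ) ^ (δ / 2) ≤ 2 := two_rpow_le_two (by linarith)
    have h4 : 0 ≤ (1 + |t₀|) ^ (δ / 2) := by positivity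
    calc ‖(((3 / 2 + δ / 2 : ℝ)) : ℂ) + t₀ * I‖ ^ (δ / 2) ≤ 2 ^ (δ / 2) * (1 + |t₀|) ^ (δ / 2) := by
          rw [← h2]; exact h1
      _ ≤ 2 * (1 + |t₀|) ^ (δ / 2) := by gcongr
  -- solve the Phragmén–Lindelöf inequality for `‖ζ(1/2 + it₀)‖`
  set a : ℝ := ‖(((-(1 / 2) : ℝ)) : ℂ) + t₀ * I‖ with ha
  set b : ℝ := ‖riemannZeta (1 / 2 + t₀ * I)‖ with hb
  set c : ℝ := ‖riemannZeta (1 / 2 + δ + t₀ * I)‖ with hc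
  set d : ℝ := ‖(((3 / 2 + δ / 2 : ℝ)) : ℂ) + t₀ * I‖ with hd
  have hdpow : 0 < d ^ (δ / 2) := Real.rpow_pos_of_pos hz1pos _
  have hneg : d ^ (-(δ / 2)) = (d ^ (δ / 2))⁻¹ := Real.rpow_neg (norm_nonneg _) _
  rw [hneg] at hPL
  have key : b ≤ C₀ * (c * d * d ^ (δ / 2)) / a := by
    rw [le_div_iff₀ hs1pos]
    have hQ : 0 < c * d * d ^ (δ / 2) := by positivity
    have h := mul_le_mul_of_nonneg_right hPL hQ.le
    have hcancel : a * b * c⁻¹ * (d⁻¹ * (d ^ (δ / 2))⁻¹) * (c * d * d ^ (δ / 2)) = b * a := by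
      field_simp
    rw [hcancel] at h
    exact h
  have hb0 : 0 ≤ b := norm_nonneg _
  calc b ≤ C₀ * (c * d * d ^ (δ / 2)) / a := key
    _ = C₀ * c * d ^ (δ / 2) * (d / a) := by field_simp
    _ ≤ C₀ * c * (2 * (1 + |t₀|) ^ (δ / 2)) * 6 := by
        gcongr
        rw [div_le_iff₀ hs1pos]
        exact hcmp1
    _ = 12 * C₀ * (1 + |t₀|) ^ (δ / 2) * c := by ring

end ZetaRatioRH

end Literature.NumberTheory.LFunctions

end
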